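import Literature.MathematicalPhysics.QuantumLattice.HubbardTTPrimeThermalPressureSlopes
import Literature.MathematicalPhysics.QuantumLattice.GibbsLogPartitionTemperatureCouplingConvexity
import Literature.Computation.Certificates.BoxCoveringByCells
import HarnessLib

/-!
# The temperature × coupling CELL RULE for the thermal pressure of the 2D `t–t'` Hubbard model, on the
# number `pressureTT'`: the JOINT tangent floor from ONE anchor with three certified brackets, and the
# Jensen ceiling from the corners of a cell

Family `hubbard` (topic `MathematicalPhysics/QuantumLattice`); the `T > 0` covering / composition layer of
stage S2 of the Hubbard material oracle («points → BOXES», D-0096 (ii)/(iii)). Sequel of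
`HubbardTTPrimeThermalPressureSlopes` (hubbard-box-p1: ONE-DIRECTION tangents of `p = pressureTT' β t s U n`
in `U` / `t'` with certified `D` / `K₂` brackets; the `β`-staircase) and of
`GibbsLogPartitionTemperatureCouplingConvexity` (finite-volume JOINT tangent plane of a linear Hamiltonian
family). The one-direction tangents do NOT chain into a joint floor (the second leg would need brackets
OFF the anchor); the joint plane does the three moves at once, with slopes = the thermal means of
`H(t,s₀,U₀)`, `K₂ = H(0,1,0)`, `D = H(0,0,1)` AT THE ANCHOR — what a producer certifies there.
Everything is PROVED; no definition, no named fact.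

* §0 arithmetic: `lo − δ ≤ x ≤ hi + δ ⇒ c·x ≤ max(c·lo, c·hi) + |c|·δ` (the sign of the increment picks the
  bracket end), and the two-point form of a certified convex combination.
* §1 FINITE VOLUME (`log_partitionFn_sector_ge_jointTangent`): the joint tangent plane of the canonical
  sector with the three thermal means written in MIXTURE form
  `Σ_i p_i Re⟨ψ_i, H_L(a,b,c) ψ_i⟩` (the form the torus-limit dictionary reads):
  `log Z_{β₀}(t,s₀,U₀) − [(β−β₀)·M(t,s₀,U₀) + β(s−s₀)·M(0,1,0) + β(U−U₀)·M(0,0,1)] ≤ log Z_β(t,s,U)`.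
* §2 THE NUMBER FORM (`pressureTT'_jointTangent_floor`, `β₀, β ≥ 0`, `U₀, U ≥ 0`, `0 ≤ n < 2`): if every
  torus limit of the canonical sector Gibbs states at the anchor `(β₀; t,s₀,U₀; n)` has
  `e_Φ ∈ [e⁻,e⁺]`, `K₂ ∈ [k⁻,k⁺]`, `D ∈ [d⁻,d⁺]`, then
  `p(β₀;t,s₀,U₀;n) − [max((β−β₀)e^∓) + max(β(s−s₀)k^∓) + max(β(U−U₀)d^∓)] ≤ p(β;t,s,U;n)` for ALL
  `(β, s, U)`; colder-than-anchor form `…_of_le` (`β ≥ β₀`: the energy term is `(β−β₀)e⁺`).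
* §3 CEILINGS ON A TEMPERATURE × COUPLING CELL (the other face of the same convexity): two-point Jensen
  steps along `U`, `t'`, `β` (`pressureTT'_le_convexComb_U/_tPrime/_beta`, read through
  `p(β;t,s,U) = p(1;βt,βs,βU)`), and THE CORNER RULE `pressureTT'_le_on_cell_of_corners`: `p ≤ V` at the
  eight corners `(βᵢ, sⱼ, U_k)` of `[β₁,β₂]×[s₁,s₂]×[U₁,U₂]` (`β₁, U₁ ≥ 0`) ⇒ `p ≤ V` on the cell; by
  antitonicity in `U` the FOUR lower-`U` corners suffice (`pressureTT'_le_on_cell_of_lowerU_corners`).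

Use (companion `HubbardTTPrimeThermalPressureBoxWords`): two anchors at the density ends of a `(β,U,t',n)` box
floor the pressure on the box (concavity in `n`); the exact hot anchor `p(0;m) = 2H_b(m/2)` turns the floor
into a thermal-energy CAP. Kinematic brackets (`0 ≤ D ≤ n/2`, `|K₂| ≤ 4n`, `e₀ ≤ e_Φ`) always exist;
certified ones (three pressures, `…Slopes`; cluster / Markov / KMS rows) tighten the slopes.

WHAT THIS IS NOT: a certificate or a number of record; a phase word; a grand-canonical statement.

## Mathlib / tree search

`lean search 'jointTangent|on_cell_of_corners|pressureTT.*docc.*diagHop'`: one-direction tangents only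
(`pressureTT'_sub_mul_le_pressureTT'_of_docc_cap`, `…_of_diagHop_cap`, staircase steps). REUSED:
`log_partitionFn_linear_ge_tangent_temperature`, `sectorHamiltonianTT'_linear`, `sectorHamiltonianTT'_eq_smul_add`,
`isHermitian_sectorHamiltonianTT'`, `nonempty_szConfig`, `re_gibbsState_sectorHamiltonianTT'_coupling`,
`re_sum_torusAvgExpect_meanEnergyObs_eq`, `eventually_re_sectorGibbsAvg_le/ge_of_forall_torusLimit`,
`le_pressureTT'_iff`, `exists_isTorusLimitOfMixture_sectorGibbs`, `convexOn_pressureTT'_one`, `pressureTT'_scale`,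
`pressureTT'_anti_U`, `BoxCovering.exists_convexWeights_Icc`.

## References

* E. H. Lieb, Adv. Math. 11 (1973) 267, §V (5.2)–(5.4) (Peierls–Bogoliubov tangent). [cite: Lieb1973, §V (5.2)–(5.4)]
* R. B. Israel, *Convexity in the Theory of Lattice Gases* (1979), Thm. I.3.4 (joint convexity of the pressure
  in the interaction, temperature absorbed), Thm. I.2.4. [cite: Israel1979, Thm. I.3.4]
* R. B. Griffiths, J. Math. Phys. 5 (1964) 1215, §2. [cite: Griffiths1964, §2]
* A. Neumaier, Acta Numerica 13 (2004), §11 (interval bookkeeping). [cite: Neumaier2004CompleteSearch, §11]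
-/

noncomputable section

namespace Literature.MathematicalPhysics.QuantumLattice

open Matrix Finset HubbardWave0 Literature.Probability.LatticeModels ThermodynamicLimit
open Literature.Computation.Certificates
open _root_.Filter
open scoped _root_.Topology ComplexOrder BigOperators

/-! ### §0 Arithmetic: a bracketed slope times a signed increment -/

/-- `lo − δ ≤ x ≤ hi + δ` ⇒ `c·x ≤ max (c·lo) (c·hi) + |c|·δ` (the sign of `c` picks the bracket end).
[cite: Neumaier2004CompleteSearch, §11] -/
theorem mul_le_max_mul_add_abs_mul {c x lo hi δ : ℝ} (h1 : lo - δ ≤ x) (h2 : x ≤ hi + δ) :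
    c * x ≤ max (c * lo) (c * hi) + |c| * δ := by
  rcases le_or_gt 0 c with hc | hc
  · rw [abs_of_nonneg hc]
    have : c * x ≤ c * (hi + δ) := mul_le_mul_of_nonneg_left h2 hc
    have : c * hi ≤ max (c * lo) (c * hi) := le_max_right _ _
    nlinarith
  · rw [abs_of_neg hc]
    have : c * x ≤ c * (lo - δ) := mul_le_mul_of_nonpos_left h1 hc.le
    have : c * lo ≤ max (c * lo) (c * hi) := le_max_left _ _
    nlinarith

/-- `lo ≤ x ≤ hi` ⇒ `c·x ≤ max (c·lo) (c·hi)`. [cite: Neumaier2004CompleteSearch, §11] -/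
theorem mul_le_max_mul_of_mem {c x lo hi : ℝ} (h1 : lo ≤ x) (h2 : x ≤ hi) :
    c * x ≤ max (c * lo) (c * hi) := by
  have h := mul_le_max_mul_add_abs_mul (c := c) (δ := 0) (by simpa using h1) (by simpa using h2)
  simpa using h

/-- A two-point Jensen step turns two certified ceilings into a ceiling at the barycentre: if
`p x ≤ l·p a + m·p b`, `p a ≤ V`, `p b ≤ V` (`l, m ≥ 0`, `l + m = 1`) then `p x ≤ V`.
[cite: Neumaier2004CompleteSearch, §11] -/
theorem le_of_convexComb_le {px pa pb l m V : ℝ} (h : px ≤ l * pa + m * pb) (hl : 0 ≤ l) (hm : 0 ≤ m)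
    (hlm : l + m = 1) (ha : pa ≤ V) (hb : pb ≤ V) : px ≤ V := by
  have h1 := mul_le_mul_of_nonneg_left ha hl
  have h2 := mul_le_mul_of_nonneg_left hb hm
  have h3 : l * V + m * V = V := by rw [← add_mul, hlm, one_mul]
  linarith

/-! ### §1 Finite volume: the joint tangent plane of the canonical sector in mixture form -/

section FiniteVolume

/-- **The temperature × coupling tangent plane of the canonical sector, thermal means in mixture form**
(`0 ≤ n ≤ 2`, any `L`, any real `β, β₀`): with `M(a,b,c) = Σ_i p_i Re⟨ψ_i, H_L(a,b,c) ψ_i⟩` the thermal mean of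
`H_L(a,b,c)` in the canonical sector Gibbs state of `H_L(t,s₀,U₀)` at `β₀`,
`log Z_{β₀}(t,s₀,U₀) − [(β−β₀)·M(t,s₀,U₀) + β(s−s₀)·M(0,1,0) + β(U−U₀)·M(0,0,1)] ≤ log Z_β(t,s,U)`.
[cite: Lieb1973, §V (5.2)–(5.4)] [cite: Israel1979, Thm. I.3.4] -/
theorem log_partitionFn_sector_ge_jointTangent {n : ℝ} (hn0 : 0 ≤ n) (hn2 : n ≤ 2) (L : ℕ)
    (β β₀ t s s₀ U U₀ : ℝ) :
    Real.log (partitionFn β₀ (sectorHamiltonianTT' t s₀ U₀ n L)).re -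
        ((β - β₀) * ∑ i, sectorGibbsWeightTT' β₀ t s₀ U₀ n L i *
            (expect (hubbardTorusTT' L t s₀ U₀) (sectorGibbsVectorTT' t s₀ U₀ n L i)).re +
          β * (s - s₀) * ∑ i, sectorGibbsWeightTT' β₀ t s₀ U₀ n L i *
            (expect (hubbardTorusTT' L 0 1 0) (sectorGibbsVectorTT' t s₀ U₀ n L i)).re +
          β * (U - U₀) * ∑ i, sectorGibbsWeightTT' β₀ t s₀ U₀ n L i *
            (expect (hubbardTorusTT' L 0 0 1) (sectorGibbsVectorTT' t s₀ U₀ n L i)).re) ≤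
      Real.log (partitionFn β (sectorHamiltonianTT' t s U n L)).re := by
  haveI := nonempty_szConfig hn0 hn2 L
  have h := log_partitionFn_linear_ge_tangent_temperature
    (H := fun q : ℝ × ℝ × ℝ => sectorHamiltonianTT' q.1 q.2.1 q.2.2 n L)
    (fun x y a b => sectorHamiltonianTT'_linear L n x y a b)
    (fun q => isHermitian_sectorHamiltonianTT' q.1 q.2.1 q.2.2 n L) β β₀ (t, s, U) (t, s₀, U₀)
  simp only at h
  have hW : (β : ℂ) • sectorHamiltonianTT' t s U n L - (β₀ : ℂ) • sectorHamiltonianTT' t s₀ U₀ n L =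
      ((β - β₀ : ℝ) : ℂ) • sectorHamiltonianTT' t s₀ U₀ n L +
        ((β * (s - s₀) : ℝ) : ℂ) • sectorHamiltonianTT' 0 1 0 n L +
          ((β * (U - U₀) : ℝ) : ℂ) • sectorHamiltonianTT' 0 0 1 n L := by
    simp only [sectorHamiltonianTT'_eq_smul_add, Complex.ofReal_sub, Complex.ofReal_mul, Complex.ofReal_zero,
      Complex.ofReal_one, zero_smul, one_smul, zero_add, add_zero]
    module
  rw [hW, map_add, map_add, map_smul, map_smul, map_smul, smul_eq_mul, smul_eq_mul, smul_eq_mul,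
    Complex.add_re, Complex.add_re, Complex.re_ofReal_mul, Complex.re_ofReal_mul, Complex.re_ofReal_mul,
    re_gibbsState_sectorHamiltonianTT'_coupling, re_gibbsState_sectorHamiltonianTT'_coupling,
    re_gibbsState_sectorHamiltonianTT'_coupling] at h
  linarith

end FiniteVolume

namespace ThermodynamicLimit

/-! ### §2 The JOINT tangent floor on the number `pressureTT'` from ONE anchor and three brackets -/

section JointTangent

variable {n : ℝ} (hn0 : 0 ≤ n) (hn2 : n < 2)
include hn0 hn2
set_option maxHeartbeats 400000 in
/-- **JOINT TANGENT FLOOR of the pressure from ONE anchor** (`β₀, β ≥ 0`, `U₀, U ≥ 0`, `0 ≤ n < 2`, any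
`t, s₀, s`). If EVERY torus limit `ω` of the canonical sector Gibbs states of `H(t,s₀,U₀)` at `(β₀, n)` has
thermal energy `e_Φ(ω) ∈ [e⁻, e⁺]`, diagonal kinetic density `K₂(ω) ∈ [k⁻, k⁺]` and double occupancy
`D(ω) ∈ [d⁻, d⁺]`, then at EVERY temperature and coupling
`p(β₀;t,s₀,U₀;n) − [max((β−β₀)e^∓) + max(β(s−s₀)k^∓) + max(β(U−U₀)d^∓)] ≤ p(β;t,s,U;n)`
(each `max` over the two bracket ends: the sign of the increment picks the end). The three one-direction
tangents of the tree (`β`: the staircase steps; `s`: `…_of_diagHop_cap/floor`; `U`: `…_of_docc_cap/floor`) are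
its faces; the joint plane is NOT their sum taken one after the other (that would need brackets off the
anchor). [cite: Lieb1973, §V (5.2)–(5.4)] [cite: Israel1979, Thm. I.3.4] [cite: Griffiths1964, §2] -/
theorem pressureTT'_jointTangent_floor {β₀ β : ℝ} (hβ₀ : 0 ≤ β₀) (hβ : 0 ≤ β) (t : ℝ) {s₀ s U₀ U : ℝ}
    (hU₀ : 0 ≤ U₀) (hU : 0 ≤ U) {elo ehi klo khi dlo dhi : ℝ}
    (he : ∀ (ω : InfVolFermionState 2) (Ls : ℕ → ℕ), Tendsto Ls atTop atTop →
      ω.IsTorusLimitOfMixture (sectorGibbsCount n) (fun L => sectorGibbsWeightTT' β₀ t s₀ U₀ n L)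
        (fun L => sectorGibbsVectorTT' t s₀ U₀ n L) Ls →
      elo ≤ ω.meanEnergy (hubbardTTPrimeFermionInteraction t s₀ U₀) 1 ∧
        ω.meanEnergy (hubbardTTPrimeFermionInteraction t s₀ U₀) 1 ≤ ehi)
    (hk : ∀ (ω : InfVolFermionState 2) (Ls : ℕ → ℕ), Tendsto Ls atTop atTop →
      ω.IsTorusLimitOfMixture (sectorGibbsCount n) (fun L => sectorGibbsWeightTT' β₀ t s₀ U₀ n L)
        (fun L => sectorGibbsVectorTT' t s₀ U₀ n L) Ls →
      klo ≤ ω.meanEnergy (hubbardTTPrimeFermionInteraction 0 1 0) 1 ∧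
        ω.meanEnergy (hubbardTTPrimeFermionInteraction 0 1 0) 1 ≤ khi)
    (hd : ∀ (ω : InfVolFermionState 2) (Ls : ℕ → ℕ), Tendsto Ls atTop atTop →
      ω.IsTorusLimitOfMixture (sectorGibbsCount n) (fun L => sectorGibbsWeightTT' β₀ t s₀ U₀ n L)
        (fun L => sectorGibbsVectorTT' t s₀ U₀ n L) Ls →
      dlo ≤ ω.meanEnergy (hubbardTTPrimeFermionInteraction 0 0 1) 1 ∧
        ω.meanEnergy (hubbardTTPrimeFermionInteraction 0 0 1) 1 ≤ dhi) :
    pressureTT' β₀ t s₀ U₀ n -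
        (max ((β - β₀) * elo) ((β - β₀) * ehi) + max (β * (s - s₀) * klo) (β * (s - s₀) * khi) +
          max (β * (U - U₀) * dlo) (β * (U - U₀) * dhi)) ≤
      pressureTT' β t s U n := by
  set M := max ((β - β₀) * elo) ((β - β₀) * ehi) + max (β * (s - s₀) * klo) (β * (s - s₀) * khi) +
    max (β * (U - U₀) * dlo) (β * (U - U₀) * dhi) with hM
  refine (le_pressureTT'_iff hβ t s hU hn0 hn2).2 fun ε hε => ?_
  set K := |β - β₀| + |β * (s - s₀)| + |β * (U - U₀)| + 1 with hK
  have hKpos : 0 < K := by positivity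
  have hδ : 0 < ε / 2 / K := by positivity
  have hε2 : 0 < ε / 2 := by positivity
  -- the anchor floor `p(β₀) − ε/2` eventually
  have hW := (le_pressureTT'_iff hβ₀ t s₀ hU₀ hn0 hn2).1 le_rfl (ε / 2) hε2
  -- the six bracket bounds on the finite-volume thermal means, eventually
  have he1 := eventually_re_sectorGibbsAvg_ge_of_forall_torusLimit t s₀ U₀ hn0 hn2.le β₀
    (thicken ({0} : Finset (Site 2)) 1) ((hubbardTTPrimeFermionInteraction t s₀ U₀).meanEnergyObs 1)
    (b := elo) (fun ω Ls hLs hω => (he ω Ls hLs hω).1) hδ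
  have he2 := eventually_re_sectorGibbsAvg_le_of_forall_torusLimit t s₀ U₀ hn0 hn2.le β₀
    (thicken ({0} : Finset (Site 2)) 1) ((hubbardTTPrimeFermionInteraction t s₀ U₀).meanEnergyObs 1)
    (b := ehi) (fun ω Ls hLs hω => (he ω Ls hLs hω).2) hδ
  have hk1 := eventually_re_sectorGibbsAvg_ge_of_forall_torusLimit t s₀ U₀ hn0 hn2.le β₀
    (thicken ({0} : Finset (Site 2)) 1) ((hubbardTTPrimeFermionInteraction 0 1 0).meanEnergyObs 1)
    (b := klo) (fun ω Ls hLs hω => (hk ω Ls hLs hω).1) hδ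
  have hk2 := eventually_re_sectorGibbsAvg_le_of_forall_torusLimit t s₀ U₀ hn0 hn2.le β₀
    (thicken ({0} : Finset (Site 2)) 1) ((hubbardTTPrimeFermionInteraction 0 1 0).meanEnergyObs 1)
    (b := khi) (fun ω Ls hLs hω => (hk ω Ls hLs hω).2) hδ
  have hd1 := eventually_re_sectorGibbsAvg_ge_of_forall_torusLimit t s₀ U₀ hn0 hn2.le β₀
    (thicken ({0} : Finset (Site 2)) 1) ((hubbardTTPrimeFermionInteraction 0 0 1).meanEnergyObs 1)
    (b := dlo) (fun ω Ls hLs hω => (hd ω Ls hLs hω).1) hδ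
  have hd2 := eventually_re_sectorGibbsAvg_le_of_forall_torusLimit t s₀ U₀ hn0 hn2.le β₀
    (thicken ({0} : Finset (Site 2)) 1) ((hubbardTTPrimeFermionInteraction 0 0 1).meanEnergyObs 1)
    (b := dhi) (fun ω Ls hLs hω => (hd ω Ls hLs hω).2) hδ
  filter_upwards [hW, he1, he2, hk1, hk2, hd1, hd2, eventually_ge_atTop 3] with L hWL he1L he2L hk1L hk2L
    hd1L hd2L hL3
  haveI : NeZero L := ⟨by omega⟩
  have hL2 : (0 : ℝ) < (L : ℝ) ^ 2 := by positivity
  rw [re_sum_torusAvgExpect_meanEnergyObs_eq β₀ t s₀ U₀ n t s₀ U₀ hL3] at he1L he2L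
  rw [re_sum_torusAvgExpect_meanEnergyObs_eq β₀ t s₀ U₀ n 0 1 0 hL3] at hk1L hk2L
  rw [re_sum_torusAvgExpect_meanEnergyObs_eq β₀ t s₀ U₀ n 0 0 1 hL3] at hd1L hd2L
  have hft := log_partitionFn_sector_ge_jointTangent hn0 hn2.le L β β₀ t s s₀ U U₀
  set Me := ∑ i, sectorGibbsWeightTT' β₀ t s₀ U₀ n L i *
    (QuantumLattice.expect (hubbardTorusTT' L t s₀ U₀) (sectorGibbsVectorTT' t s₀ U₀ n L i)).re with hMe
  set Mk := ∑ i, sectorGibbsWeightTT' β₀ t s₀ U₀ n L i *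
    (QuantumLattice.expect (hubbardTorusTT' L 0 1 0) (sectorGibbsVectorTT' t s₀ U₀ n L i)).re with hMk
  set Md := ∑ i, sectorGibbsWeightTT' β₀ t s₀ U₀ n L i *
    (QuantumLattice.expect (hubbardTorusTT' L 0 0 1) (sectorGibbsVectorTT' t s₀ U₀ n L i)).re with hMd
  clear_value Me Mk Md
  -- each slope term is at most its bracket `max` plus `|coefficient|·δ`, per unit volume
  have hte := mul_le_max_mul_add_abs_mul (c := β - β₀) he1L he2L
  have htk := mul_le_max_mul_add_abs_mul (c := β * (s - s₀)) hk1L hk2L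
  have htd := mul_le_max_mul_add_abs_mul (c := β * (U - U₀)) hd1L hd2L
  have hsum : (β - β₀) * (Me / (L : ℝ) ^ 2) + β * (s - s₀) * (Mk / (L : ℝ) ^ 2) +
      β * (U - U₀) * (Md / (L : ℝ) ^ 2) ≤ M + (K - 1) * (ε / 2 / K) := by
    rw [hM, hK]; linarith
  have hKδ : (K - 1) * (ε / 2 / K) ≤ ε / 2 := by
    rw [mul_div_assoc']
    exact (div_le_iff₀ hKpos).2 (by nlinarith [hε2.le])
  have hvol : (β - β₀) * Me + β * (s - s₀) * Mk + β * (U - U₀) * Md =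
      ((β - β₀) * (Me / (L : ℝ) ^ 2) + β * (s - s₀) * (Mk / (L : ℝ) ^ 2) +
        β * (U - U₀) * (Md / (L : ℝ) ^ 2)) * (L : ℝ) ^ 2 := by
    field_simp
  have hvol' : (β - β₀) * Me + β * (s - s₀) * Mk + β * (U - U₀) * Md ≤ (M + ε / 2) * (L : ℝ) ^ 2 := by
    rw [hvol]
    exact mul_le_mul_of_nonneg_right (by linarith) hL2.le
  nlinarith [hft, hWL, hvol']

/-- **Colder-than-anchor form** (`β ≥ β₀`): the energy term is `(β − β₀)·e⁺` — only the thermal energy CAP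
at the anchor is needed on the cold side. [cite: Lieb1973, §V (5.2)–(5.4)] [cite: Israel1979, Thm. I.3.4] -/
theorem pressureTT'_jointTangent_floor_of_le {β₀ β : ℝ} (hβ₀ : 0 ≤ β₀) (hle : β₀ ≤ β) (t : ℝ)
    {s₀ s U₀ U : ℝ} (hU₀ : 0 ≤ U₀) (hU : 0 ≤ U) {elo ehi klo khi dlo dhi : ℝ}
    (he : ∀ (ω : InfVolFermionState 2) (Ls : ℕ → ℕ), Tendsto Ls atTop atTop →
      ω.IsTorusLimitOfMixture (sectorGibbsCount n) (fun L => sectorGibbsWeightTT' β₀ t s₀ U₀ n L)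
        (fun L => sectorGibbsVectorTT' t s₀ U₀ n L) Ls →
      elo ≤ ω.meanEnergy (hubbardTTPrimeFermionInteraction t s₀ U₀) 1 ∧
        ω.meanEnergy (hubbardTTPrimeFermionInteraction t s₀ U₀) 1 ≤ ehi)
    (hk : ∀ (ω : InfVolFermionState 2) (Ls : ℕ → ℕ), Tendsto Ls atTop atTop →
      ω.IsTorusLimitOfMixture (sectorGibbsCount n) (fun L => sectorGibbsWeightTT' β₀ t s₀ U₀ n L)
        (fun L => sectorGibbsVectorTT' t s₀ U₀ n L) Ls →
      klo ≤ ω.meanEnergy (hubbardTTPrimeFermionInteraction 0 1 0) 1 ∧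
        ω.meanEnergy (hubbardTTPrimeFermionInteraction 0 1 0) 1 ≤ khi)
    (hd : ∀ (ω : InfVolFermionState 2) (Ls : ℕ → ℕ), Tendsto Ls atTop atTop →
      ω.IsTorusLimitOfMixture (sectorGibbsCount n) (fun L => sectorGibbsWeightTT' β₀ t s₀ U₀ n L)
        (fun L => sectorGibbsVectorTT' t s₀ U₀ n L) Ls →
      dlo ≤ ω.meanEnergy (hubbardTTPrimeFermionInteraction 0 0 1) 1 ∧
        ω.meanEnergy (hubbardTTPrimeFermionInteraction 0 0 1) 1 ≤ dhi) :
    pressureTT' β₀ t s₀ U₀ n -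
        ((β - β₀) * ehi + max (β * (s - s₀) * klo) (β * (s - s₀) * khi) +
          max (β * (U - U₀) * dlo) (β * (U - U₀) * dhi)) ≤
      pressureTT' β t s U n := by
  have h := pressureTT'_jointTangent_floor hn0 hn2 hβ₀ (hβ₀.trans hle) t (s := s) hU₀ hU he hk hd
  have hmax : max ((β - β₀) * elo) ((β - β₀) * ehi) ≤ (β - β₀) * ehi := by
    refine max_le ?_ le_rfl
    -- `elo ≤ ehi` follows from the brackets at any torus limit; but we only need `(β−β₀) ≥ 0`-monotonicity
    -- when `elo ≤ ehi`. If `ehi < elo` the hypothesis `he` is vacuous only if no torus limit exists; torus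
    -- limits exist, so we extract `elo ≤ ehi` from one of them.
    obtain ⟨φ, hφ, ω, hω⟩ := exists_isTorusLimitOfMixture_sectorGibbs β₀ t s₀ U₀ hn0 hn2.le tendsto_id
    have h1 := he ω (id ∘ φ) (tendsto_id.comp hφ.tendsto_atTop) hω
    exact mul_le_mul_of_nonneg_left (h1.1.trans h1.2) (sub_nonneg.2 hle)
  linarith

end JointTangent

/-! ### §3 CEILINGS over a temperature × coupling cell: two-point Jensen steps and the corner rule -/

section Jensen

variable {n : ℝ} (hn0 : 0 ≤ n) (hn2 : n < 2)
include hn0 hn2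

/-- `p(β; t,s,U; n) = p(1; βt, βs, βU; n)` (`β, U ≥ 0`): temperature absorbed into the couplings.
[cite: Israel1979, Thm. I.3.4] -/
theorem pressureTT'_eq_one {β : ℝ} (hβ : 0 ≤ β) (t s : ℝ) {U : ℝ} (hU : 0 ≤ U) :
    pressureTT' β t s U n = pressureTT' 1 (β * t) (β * s) (β * U) n := by
  rw [pressureTT'_scale zero_le_one hβ t s hU hn0 hn2, one_mul]

/-- **Two-point Jensen step in `U`** (`β ≥ 0`, `0 ≤ U₁`, `0 ≤ U₂`, weights `l, m ≥ 0`, `l + m = 1`,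
`U = l U₁ + m U₂`): `p(β;t,s,U) ≤ l·p(β;t,s,U₁) + m·p(β;t,s,U₂)`. [cite: Israel1979, Thm. I.3.4] -/
theorem pressureTT'_le_convexComb_U {β : ℝ} (hβ : 0 ≤ β) (t s : ℝ) {U₁ U₂ U l m : ℝ} (hU₁ : 0 ≤ U₁)
    (hU₂ : 0 ≤ U₂) (hl : 0 ≤ l) (hm : 0 ≤ m) (hlm : l + m = 1) (hU : l * U₁ + m * U₂ = U) :
    pressureTT' β t s U n ≤ l * pressureTT' β t s U₁ n + m * pressureTT' β t s U₂ n := by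
  have hUnn : 0 ≤ U := by rw [← hU]; positivity
  have h := (convexOn_pressureTT'_one hn0 hn2).2 (x := (β * t, β * s, β * U₁)) (y := (β * t, β * s, β * U₂))
    (by simpa using mul_nonneg hβ hU₁) (by simpa using mul_nonneg hβ hU₂) hl hm hlm
  have hc : l • ((β * t, β * s, β * U₁) : ℝ × ℝ × ℝ) + m • (β * t, β * s, β * U₂) = (β * t, β * s, β * U) := by
    ext <;> simp only [Prod.smul_mk, Prod.mk_add_mk, smul_eq_mul]
    · linear_combination (β * t) * hlm
    · linear_combination (β * s) * hlm
    · linear_combination β * hU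
  rw [hc] at h
  simp only [smul_eq_mul] at h
  rwa [pressureTT'_eq_one hn0 hn2 hβ t s hUnn, pressureTT'_eq_one hn0 hn2 hβ t s hU₁,
    pressureTT'_eq_one hn0 hn2 hβ t s hU₂]

/-- **Two-point Jensen step in `t'`** (`β ≥ 0`, `U ≥ 0`, `s = l s₁ + m s₂`):
`p(β;t,s,U) ≤ l·p(β;t,s₁,U) + m·p(β;t,s₂,U)`. [cite: Israel1979, Thm. I.3.4] -/
theorem pressureTT'_le_convexComb_tPrime {β : ℝ} (hβ : 0 ≤ β) (t : ℝ) {s₁ s₂ s : ℝ} {U : ℝ} (hU : 0 ≤ U)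
    {l m : ℝ} (hl : 0 ≤ l) (hm : 0 ≤ m) (hlm : l + m = 1) (hs : l * s₁ + m * s₂ = s) :
    pressureTT' β t s U n ≤ l * pressureTT' β t s₁ U n + m * pressureTT' β t s₂ U n := by
  have h := (convexOn_pressureTT'_one hn0 hn2).2 (x := (β * t, β * s₁, β * U)) (y := (β * t, β * s₂, β * U))
    (by simpa using mul_nonneg hβ hU) (by simpa using mul_nonneg hβ hU) hl hm hlm
  have hc : l • ((β * t, β * s₁, β * U) : ℝ × ℝ × ℝ) + m • (β * t, β * s₂, β * U) = (β * t, β * s, β * U) := by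
    ext <;> simp only [Prod.smul_mk, Prod.mk_add_mk, smul_eq_mul]
    · linear_combination (β * t) * hlm
    · linear_combination β * hs
    · linear_combination (β * U) * hlm
  rw [hc] at h
  simp only [smul_eq_mul] at h
  rwa [pressureTT'_eq_one hn0 hn2 hβ t s hU, pressureTT'_eq_one hn0 hn2 hβ t s₁ hU,
    pressureTT'_eq_one hn0 hn2 hβ t s₂ hU]

/-- **Two-point Jensen step in `β`** (`0 ≤ β₁`, `0 ≤ β₂`, `U ≥ 0`, `β = l β₁ + m β₂`):
`p(β;t,s,U) ≤ l·p(β₁;t,s,U) + m·p(β₂;t,s,U)` — a TEMPERATURE cell is capped by its two ends.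
[cite: Israel1979, Thm. I.3.4] [cite: GustafsonSigal2003, §18.3] -/
theorem pressureTT'_le_convexComb_beta {β₁ β₂ β : ℝ} (hβ₁ : 0 ≤ β₁) (hβ₂ : 0 ≤ β₂) (t s : ℝ) {U : ℝ}
    (hU : 0 ≤ U) {l m : ℝ} (hl : 0 ≤ l) (hm : 0 ≤ m) (hlm : l + m = 1) (hb : l * β₁ + m * β₂ = β) :
    pressureTT' β t s U n ≤ l * pressureTT' β₁ t s U n + m * pressureTT' β₂ t s U n := by
  have hβ : 0 ≤ β := by rw [← hb]; positivity
  have h := (convexOn_pressureTT'_one hn0 hn2).2 (x := (β₁ * t, β₁ * s, β₁ * U)) (y := (β₂ * t, β₂ * s, β₂ * U))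
    (by simpa using mul_nonneg hβ₁ hU) (by simpa using mul_nonneg hβ₂ hU) hl hm hlm
  have hc : l • ((β₁ * t, β₁ * s, β₁ * U) : ℝ × ℝ × ℝ) + m • (β₂ * t, β₂ * s, β₂ * U) =
      (β * t, β * s, β * U) := by
    ext <;> simp only [Prod.smul_mk, Prod.mk_add_mk, smul_eq_mul]
    · linear_combination t * hb
    · linear_combination s * hb
    · linear_combination U * hb
  rw [hc] at h
  simp only [smul_eq_mul] at h
  rwa [pressureTT'_eq_one hn0 hn2 hβ t s hU, pressureTT'_eq_one hn0 hn2 hβ₁ t s hU,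
    pressureTT'_eq_one hn0 hn2 hβ₂ t s hU]

/-- **THE CORNER RULE for pressure CEILINGS on a temperature × coupling cell** (`0 ≤ β₁`, `0 ≤ U₁`,
`0 ≤ n < 2`): if `p ≤ V` at the eight corners `(βᵢ, sⱼ, U_k)` of `[β₁,β₂] × [s₁,s₂] × [U₁,U₂]`, then `p ≤ V`
on the whole cell (joint convexity in the `β`-scaled couplings: a cell point is a convex combination of the
scaled corners). [cite: Israel1979, Thm. I.3.4] [cite: Neumaier2004CompleteSearch, §11] -/
theorem pressureTT'_le_on_cell_of_corners {β₁ β₂ s₁ s₂ U₁ U₂ : ℝ} (hβ₁ : 0 ≤ β₁) (hU₁ : 0 ≤ U₁) (t : ℝ)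
    {V : ℝ}
    (hV : ∀ b ∈ ({β₁, β₂} : Set ℝ), ∀ s' ∈ ({s₁, s₂} : Set ℝ), ∀ u ∈ ({U₁, U₂} : Set ℝ),
      pressureTT' b t s' u n ≤ V) :
    ∀ β ∈ Set.Icc β₁ β₂, ∀ s ∈ Set.Icc s₁ s₂, ∀ U ∈ Set.Icc U₁ U₂, pressureTT' β t s U n ≤ V := by
  intro β hβ s hs U hU
  have hβ0 : 0 ≤ β := hβ₁.trans hβ.1
  have hβ₂ : 0 ≤ β₂ := hβ₁.trans (hβ.1.trans hβ.2)
  have hU0 : 0 ≤ U := hU₁.trans hU.1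
  have hU₂ : 0 ≤ U₂ := hU₁.trans (hU.1.trans hU.2)
  obtain ⟨lU, mU, hlU, hmU, hlmU, hcU⟩ := BoxCovering.exists_convexWeights_Icc hU.1 hU.2
  obtain ⟨ls, ms, hls, hms, hlms, hcs⟩ := BoxCovering.exists_convexWeights_Icc hs.1 hs.2
  obtain ⟨lb, mb, hlb, hmb, hlmb, hcb⟩ := BoxCovering.exists_convexWeights_Icc hβ.1 hβ.2
  -- corners ⇒ the four `(s_j, U_k)` edges at the target `β`
  have hsU : ∀ s' ∈ ({s₁, s₂} : Set ℝ), ∀ u ∈ ({U₁, U₂} : Set ℝ), pressureTT' β t s' u n ≤ V := by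
    intro s' hs' u hu
    have hu0 : 0 ≤ u := by rcases hu with rfl | rfl <;> assumption
    exact le_of_convexComb_le (pressureTT'_le_convexComb_beta hn0 hn2 hβ₁ hβ₂ t s' hu0 hlb hmb hlmb hcb) hlb hmb
      hlmb (hV β₁ (by simp) s' hs' u hu) (hV β₂ (by simp) s' hs' u hu)
  -- ⇒ the two `U_k` points at the target `(β, s)`
  have hUk : ∀ u ∈ ({U₁, U₂} : Set ℝ), pressureTT' β t s u n ≤ V := by
    intro u hu
    have hu0 : 0 ≤ u := by rcases hu with rfl | rfl <;> assumption
    exact le_of_convexComb_le (pressureTT'_le_convexComb_tPrime hn0 hn2 hβ0 t hu0 hls hms hlms hcs) hls hms hlms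
      (hsU s₁ (by simp) u hu) (hsU s₂ (by simp) u hu)
  exact le_of_convexComb_le (pressureTT'_le_convexComb_U hn0 hn2 hβ0 t s hU₁ hU₂ hlU hmU hlmU hcU) hlU hmU hlmU
    (hUk U₁ (by simp)) (hUk U₂ (by simp))

/-- **Corner rule with the `U`-monotonicity built in**: `p` is antitone in `U`, so the FOUR corners
`(βᵢ, sⱼ, U₁)` at the LOWER `U`-face suffice: `p(βᵢ;t,sⱼ,U₁) ≤ V ⇒ p ≤ V` on
`[β₁,β₂] × [s₁,s₂] × [U₁,U₂]` (any `U₂`). [cite: Israel1979, Thm. I.3.4] -/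
theorem pressureTT'_le_on_cell_of_lowerU_corners {β₁ β₂ s₁ s₂ U₁ U₂ : ℝ} (hβ₁ : 0 ≤ β₁) (hU₁ : 0 ≤ U₁)
    (t : ℝ) {V : ℝ}
    (hV : ∀ b ∈ ({β₁, β₂} : Set ℝ), ∀ s' ∈ ({s₁, s₂} : Set ℝ), pressureTT' b t s' U₁ n ≤ V) :
    ∀ β ∈ Set.Icc β₁ β₂, ∀ s ∈ Set.Icc s₁ s₂, ∀ U ∈ Set.Icc U₁ U₂, pressureTT' β t s U n ≤ V := by
  intro β hβ s hs U hU
  have hβ0 : 0 ≤ β := hβ₁.trans hβ.1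
  have hface := pressureTT'_le_on_cell_of_corners hn0 hn2 hβ₁ hU₁ t (β₂ := β₂) (s₂ := s₂) (U₂ := U₁) (V := V)
    (fun b hb s' hs' u hu => by
      have : u = U₁ := by simpa using hu
      rw [this]; exact hV b hb s' hs') β hβ s hs U₁ ⟨le_rfl, le_rfl⟩
  exact (pressureTT'_anti_U hn0 hn2 hβ0 t s hU₁ hU.1).trans hface

end Jensen

end ThermodynamicLimit

end Literature.MathematicalPhysics.QuantumLattice

end
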